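import Mathlib
import Literature.MathematicalPhysics.QuantumFieldTheory.LatticeMirrorNormals
import HarnessLib

/-!
# `B₂` pairs of lattice mirror normals of `ℤ³` and their bisectors

Topic `Literature/MathematicalPhysics/QuantumFieldTheory`.  Among the nine lattice mirror normals
`e_i`, `e_i ± e_j` of `ℤ³` (`latticeMirrorNormals (Fin 3)`, the `B₃` arrangement), a **`B₂` pair**
is an orthogonal pair of equal length: `(e_i, e_j)` (`i ≠ j`) or `(e_i ± e_j, ±(e_i ∓ e_j))`.  The
point used by the in-plane light-cone argument of the critical-Ising rotation programme is that
the four mirrors of a coordinate plane are closed under bisection: **both bisectors `n + n'` and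
`n - n'` of a `B₂` pair are nonzero multiples of lattice mirror normals**
(`exists_bisectors_of_B2Pair`: `e_i ± e_j`, resp. `±2 e_i`, `±2 e_j`).  The proof is a finite case
analysis of the inner products `⟪n, n'⟫ ∈ ℤ` (`inner_single_*` of `LatticeMirrorNormals.lean`);
the only non-trivial exclusion is that two disjoint index pairs do not fit into `Fin 3`.

## References
* A. Björner, F. Brenti, *Combinatorics of Coxeter Groups* (2005), §8.1 (type `B`). [folklore]
-/

noncomputable section

open scoped InnerProductSpace

namespace Literature.MathematicalPhysics.QuantumFieldTheory

/-- Coordinates of lattice vectors: `(e_k) i`, `(e_k ± e_l) i` as indicators. [folklore] -/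
theorem single_apply_eq_ite (k i : Fin 3) :
    (EuclideanSpace.single k (1 : ℝ)) i = if i = k then 1 else 0 := by
  rw [PiLp.single_apply]

/-- `‖e_i‖ = 1`. [folklore] -/
theorem norm_single_one (i : Fin 3) : ‖EuclideanSpace.single i (1 : ℝ)‖ = 1 := by simp

/-- `‖e_i + e_j‖² = 2` for `i ≠ j`. [folklore] -/
theorem norm_sq_single_add_single {i j : Fin 3} (hij : i ≠ j) :
    ‖EuclideanSpace.single i (1 : ℝ) + EuclideanSpace.single j 1‖ ^ 2 = 2 := by
  rw [← real_inner_self_eq_norm_sq, inner_single_add_single_left]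
  simp [hij, Ne.symm hij]; norm_num

/-- `‖e_i - e_j‖² = 2` for `i ≠ j`. [folklore] -/
theorem norm_sq_single_sub_single {i j : Fin 3} (hij : i ≠ j) :
    ‖EuclideanSpace.single i (1 : ℝ) - EuclideanSpace.single j 1‖ ^ 2 = 2 := by
  rw [← real_inner_self_eq_norm_sq, inner_single_sub_single_left]
  simp [hij, Ne.symm hij]; norm_num

/-- Four indices of `Fin 3` are not pairwise distinct. [folklore] -/
theorem fin3_not_four_distinct (i j k l : Fin 3) (hij : i ≠ j) (hkl : k ≠ l) (hik : i ≠ k) (hil : i ≠ l)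
    (hjk : j ≠ k) (hjl : j ≠ l) : False := by
  have h1 : i.val ≠ j.val := fun h => hij (Fin.ext h)
  have h2 : k.val ≠ l.val := fun h => hkl (Fin.ext h)
  have h3 : i.val ≠ k.val := fun h => hik (Fin.ext h)
  have h4 : i.val ≠ l.val := fun h => hil (Fin.ext h)
  have h5 : j.val ≠ k.val := fun h => hjk (Fin.ext h)
  have h6 : j.val ≠ l.val := fun h => hjl (Fin.ext h)
  have := i.isLt; have := j.isLt; have := k.isLt; have := l.isLt
  omega

/-- **The bisectors of a `B₂` pair of lattice mirror normals of `ℤ³` are nonzero multiples of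
lattice mirror normals.**  If `n, n' ∈ latticeMirrorNormals (Fin 3)` are orthogonal and of equal
length then `n + n' = c • m` and `n - n' = c' • m'` with `c, c' ≠ 0` and `m, m'` lattice mirror
normals (`(e_i, e_j) ↦ e_i ± e_j`; `(e_i ± e_j, ±(e_i ∓ e_j)) ↦ ±2e_i, ±2e_j`). [folklore] -/
theorem exists_bisectors_of_B2Pair {n n' : EuclideanSpace ℝ (Fin 3)}
    (hn : n ∈ latticeMirrorNormals (Fin 3)) (hn' : n' ∈ latticeMirrorNormals (Fin 3))
    (horth : ⟪n, n'⟫_ℝ = 0) (hlen : ‖n‖ = ‖n'‖) :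
    (∃ (c : ℝ) (m : EuclideanSpace ℝ (Fin 3)), c ≠ 0 ∧ m ∈ latticeMirrorNormals (Fin 3) ∧ n + n' = c • m) ∧
    (∃ (c : ℝ) (m : EuclideanSpace ℝ (Fin 3)), c ≠ 0 ∧ m ∈ latticeMirrorNormals (Fin 3) ∧ n - n' = c • m) := by
  have hlen2 : ‖n‖ ^ 2 = ‖n'‖ ^ 2 := by rw [hlen]
  obtain ⟨i, j, hij, rfl | rfl | rfl⟩ := hn <;> obtain ⟨k, l, hkl, rfl | rfl | rfl⟩ := hn'
  -- (e_i, e_k)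
  · have hik : i ≠ k := by
      intro h; subst h
      rw [inner_single_one_left] at horth
      simp at horth
    exact ⟨⟨1, _, one_ne_zero, single_add_single_mem_latticeMirrorNormals hik, (one_smul _ _).symm⟩,
      ⟨1, _, one_ne_zero, single_sub_single_mem_latticeMirrorNormals hik, (one_smul _ _).symm⟩⟩
  -- (e_i, e_k + e_l): lengths differ
  · rw [norm_single_one, norm_sq_single_add_single hkl] at hlen2; norm_num at hlen2
  -- (e_i, e_k - e_l)
  · rw [norm_single_one, norm_sq_single_sub_single hkl] at hlen2; norm_num at hlen2
  -- (e_i + e_j, e_k)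
  · rw [norm_single_one, norm_sq_single_add_single hij] at hlen2; norm_num at hlen2
  -- (e_i + e_j, e_k + e_l): four distinct indices
  · exfalso
    rw [inner_single_add_single_left] at horth
    simp only [PiLp.add_apply, single_apply_eq_ite] at horth
    have hnn : ∀ (P : Prop) [Decidable P], (0 : ℝ) ≤ if P then 1 else 0 := fun P _ => by split_ifs <;> norm_num
    have h1 : i ≠ k := fun h => by
      have := hnn (i = l); have := hnn (j = k); have := hnn (j = l); rw [if_pos h] at horth; linarith
    have h2 : i ≠ l := fun h => by
      have := hnn (i = k); have := hnn (j = k); have := hnn (j = l); rw [if_pos h] at horth; linarith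
    have h3 : j ≠ k := fun h => by
      have := hnn (i = k); have := hnn (i = l); have := hnn (j = l); rw [if_pos h] at horth; linarith
    have h4 : j ≠ l := fun h => by
      have := hnn (i = k); have := hnn (i = l); have := hnn (j = k); rw [if_pos h] at horth; linarith
    exact fin3_not_four_distinct i j k l hij hkl h1 h2 h3 h4
  -- (e_i + e_j, e_k - e_l): {k, l} = {i, j}
  · rw [inner_single_add_single_left] at horth
    simp only [PiLp.sub_apply, single_apply_eq_ite] at horth
    by_cases hik : i = k
    · subst hik
      have hjl : j = l := by
        by_contra hjl
        simp [Ne.symm hij, hjl, hkl] at horth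
      subst hjl
      -- n' = e_i - e_j: n + n' = 2 e_i, n - n' = 2 e_j
      refine ⟨⟨2, EuclideanSpace.single i 1, two_ne_zero, single_mem_latticeMirrorNormals hij, ?_⟩,
        ⟨2, EuclideanSpace.single j 1, two_ne_zero, single_mem_latticeMirrorNormals (Ne.symm hij), ?_⟩⟩
      · rw [two_smul]; abel
      · rw [two_smul]; abel
    · by_cases hil : i = l
      · subst hil
        have hjk : j = k := by
          by_contra hjk
          simp [hik, hjk, Ne.symm hij] at horth
        subst hjk
        -- n' = e_j - e_i: n + n' = 2 e_j, n - n' = 2 e_i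
        refine ⟨⟨2, EuclideanSpace.single j 1, two_ne_zero, single_mem_latticeMirrorNormals (Ne.symm hij), ?_⟩,
          ⟨2, EuclideanSpace.single i 1, two_ne_zero, single_mem_latticeMirrorNormals hij, ?_⟩⟩
        · rw [two_smul]; abel
        · rw [two_smul]; abel
      · exfalso
        by_cases hjk : j = k
        · subst hjk
          simp [hik, hil, hkl] at horth
        · by_cases hjl : j = l
          · subst hjl
            simp [hik, hil, hjk] at horth
          · exact fin3_not_four_distinct i j k l hij hkl hik hil hjk hjl
  -- (e_i - e_j, e_k)
  · rw [norm_single_one, norm_sq_single_sub_single hij] at hlen2; norm_num at hlen2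
  -- (e_i - e_j, e_k + e_l): {k, l} = {i, j}
  · rw [inner_single_sub_single_left] at horth
    simp only [PiLp.add_apply, single_apply_eq_ite] at horth
    by_cases hik : i = k
    · subst hik
      have hjl : j = l := by
        by_contra hjl
        simp [Ne.symm hij, hjl, hkl] at horth
      subst hjl
      -- n' = e_i + e_j: n + n' = 2 e_i, n - n' = -2 e_j
      refine ⟨⟨2, EuclideanSpace.single i 1, two_ne_zero, single_mem_latticeMirrorNormals hij, ?_⟩,
        ⟨-2, EuclideanSpace.single j 1, by norm_num, single_mem_latticeMirrorNormals (Ne.symm hij), ?_⟩⟩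
      · rw [two_smul]; abel
      · rw [neg_smul, two_smul]; abel
    · by_cases hil : i = l
      · subst hil
        have hjk : j = k := by
          by_contra hjk
          simp [hik, hjk, Ne.symm hij] at horth
        subst hjk
        -- n' = e_j + e_i: n + n' = 2 e_i, n - n' = -2 e_j
        refine ⟨⟨2, EuclideanSpace.single i 1, two_ne_zero, single_mem_latticeMirrorNormals hij, ?_⟩,
          ⟨-2, EuclideanSpace.single j 1, by norm_num, single_mem_latticeMirrorNormals (Ne.symm hij), ?_⟩⟩
        · rw [two_smul]; abel
        · rw [neg_smul, two_smul]; abel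
      · exfalso
        by_cases hjk : j = k
        · subst hjk
          simp [hik, hil, hkl] at horth
        · by_cases hjl : j = l
          · subst hjl
            simp [hik, hil, hjk] at horth
          · exact fin3_not_four_distinct i j k l hij hkl hik hil hjk hjl
  -- (e_i - e_j, e_k - e_l): impossible
  · exfalso
    rw [inner_single_sub_single_left] at horth
    simp only [PiLp.sub_apply, single_apply_eq_ite] at horth
    by_cases hik : i = k
    · subst hik
      by_cases hjl : j = l
      · subst hjl; simp [Ne.symm hij, hij] at horth
      · simp [Ne.symm hij, hjl, hkl] at horth
    · by_cases hil : i = l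
      · subst hil
        by_cases hjk : j = k
        · subst hjk; norm_num [hij, Ne.symm hij] at horth
        · simp [hik, hjk, Ne.symm hij] at horth
      · by_cases hjk : j = k
        · subst hjk
          simp [hik, hil, hkl] at horth
        · by_cases hjl : j = l
          · subst hjl
            simp [hik, hil, hjk] at horth
          · exact fin3_not_four_distinct i j k l hij hkl hik hil hjk hjl

end Literature.MathematicalPhysics.QuantumFieldTheory
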